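import Mathlib
import Summits.Parity.BatemanHorn.Theorems.IsogenyRedeiDefs
import HarnessLib

/-!
# Type-I main term for Bateman–Horn (stmt-Parity-0873), input B1:
# the subset algebra `Λ_k = ℝ[ε_1, …, ε_k]/(ε_i²)`

To handle the weight `∏_i log d_i` of the Type-I main term multiplicatively we work in the
commutative real algebra generated by `k` elements `ε_i` of square zero: there
`n ↦ 1 + ε_i log n` is *completely multiplicative*, and `∏_i (μ(d_i) + ε_i μ(d_i) log d_i)`
has top coefficient `∏_i μ(d_i) log d_i`. We realise `Λ_k` concretely as functions on the
subsets of `Fin k` with the disjoint-union convolution product: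

* `SAlg k` (functions `Finset (Fin k) → ℝ`), a `CommRing` and `ℝ`-algebra with
  `(x * y)(S) = ∑_{T ⊆ S} x(T) y(S ∖ T)`, unit `δ_∅`;
* `SAlg.lin i a b = a + b ε_i` and `lin_mul_lin : lin i a b * lin i a' b' = lin i (aa') (ab' + a'b)`;
* `SAlg.mul_lin_apply` — `(x * lin i a b)(S) = a x(S) + b [i ∈ S] x(S ∖ {i})`;
* `SAlg.norm1 x = ∑_S |x(S)|`, submultiplicative (`norm1_mul_le`), with `|x(S)| ≤ norm1 x`.

Everything here is proved. [folklore]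
-/

noncomputable section

open Finset

namespace Summit.Parity.BatemanHorn.Theorems.TypeIMainTerm

namespace SAlg

variable {k : ℕ}

/-- Scalars act compatibly with the product: `(c • x) y = c • (x y)`. -/
theorem smul_mul (c : ℝ) (x y : SAlg k) : (c • x) * y = c • (x * y) := by
  ext S; simp [coeff_mul, Finset.mul_sum, mul_assoc]

/-- `x (c • y) = c • (x y)`. -/
theorem mul_smul' (c : ℝ) (x y : SAlg k) : x * (c • y) = c • (x * y) := by
  rw [mul_comm', smul_mul, mul_comm']

/-! ### The generators `a + b ε_i` -/

/-- `coeff (lin i a b) ∅ = a`. -/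
@[simp] theorem coeff_lin_empty (i : Fin k) (a b : ℝ) : coeff (lin i a b) ∅ = a := by
  simp [coeff_lin]

/-- `coeff (lin i a b) {i} = b`. -/
@[simp] theorem coeff_lin_singleton (i : Fin k) (a b : ℝ) : coeff (lin i a b) {i} = b := by
  simp [coeff_lin, (Finset.singleton_ne_empty i)]

/-- `lin i 1 0 = (1 : SAlg k)`. -/
theorem lin_one_zero (i : Fin k) : lin i 1 0 = (1 : SAlg k) := by
  ext S; simp only [coeff_lin, coeff_one]; split_ifs <;> rfl

/-- **Multiplication by a generator**: `(x · (a + b ε_i))(S) = a x(S) + b [i ∈ S] x(S ∖ {i})`. -/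
theorem coeff_mul_lin (x : SAlg k) (i : Fin k) (a b : ℝ) (S : Finset (Fin k)) :
    coeff (x * lin i a b) S = a * coeff x S + if i ∈ S then b * coeff x (S \ {i}) else 0 := by
  rw [coeff_mul]
  -- only `T = S` and `T = S \ {i}` contribute
  have key : ∀ T ∈ S.powerset, coeff x T * coeff (lin i a b) (S \ T) =
      (if T = S then a * coeff x S else 0) + (if i ∈ S ∧ T = S \ {i} then b * coeff x (S \ {i}) else 0) := by
    intro T hT
    have hTS : T ⊆ S := Finset.mem_powerset.mp hT
    rw [coeff_lin]
    by_cases h1 : T = S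
    · subst h1
      simp only [Finset.sdiff_self, if_true]
      rw [if_neg, add_zero, mul_comm]
      rintro ⟨hi, hS⟩
      have : i ∉ T \ {i} := by simp
      exact this (hS ▸ hi)
    · rw [if_neg h1, zero_add]
      have hne : S \ T ≠ ∅ := by
        intro h; apply h1
        exact Finset.Subset.antisymm hTS (Finset.sdiff_eq_empty_iff_subset.mp h)
      rw [if_neg hne]
      by_cases h2 : S \ T = {i}
      · rw [if_pos h2]
        have hi : i ∈ S := by
          have : i ∈ S \ T := by rw [h2]; exact Finset.mem_singleton_self i
          exact (Finset.mem_sdiff.mp this).1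
        have hT' : T = S \ {i} := by
          rw [← h2, Finset.sdiff_sdiff_eq_self hTS]
        rw [if_pos ⟨hi, hT'⟩, hT', mul_comm]
      · rw [if_neg h2, mul_zero, if_neg]
        rintro ⟨hi, hT'⟩
        apply h2
        rw [hT', Finset.sdiff_sdiff_eq_self (Finset.singleton_subset_iff.mpr hi)]
  rw [Finset.sum_congr rfl key, Finset.sum_add_distrib, Finset.sum_ite_eq' S.powerset S,
    if_pos (Finset.mem_powerset.mpr Finset.Subset.rfl)]
  congr 1
  by_cases hi : i ∈ S
  · rw [if_pos hi]
    simp only [hi, true_and]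
    rw [Finset.sum_ite_eq' S.powerset (S \ {i}), if_pos (Finset.mem_powerset.mpr sdiff_subset)]
  · rw [if_neg hi]
    simp [hi]

/-- **`ε_i² = 0`**: `(a + b ε_i)(a' + b' ε_i) = aa' + (ab' + a'b) ε_i`. -/
theorem lin_mul_lin (i : Fin k) (a b a' b' : ℝ) :
    lin i a b * lin i a' b' = lin i (a * a') (a * b' + a' * b) := by
  ext S
  rw [coeff_mul_lin, coeff_lin i (a * a')]
  by_cases h0 : S = ∅
  · subst h0; simp [mul_comm]
  rw [if_neg h0]
  by_cases h1 : S = {i}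
  · subst h1; simp; ring
  rw [if_neg h1]
  have hS : coeff (lin i a b) S = 0 := by rw [coeff_lin, if_neg h0, if_neg h1]
  rw [hS, mul_zero, zero_add]
  split_ifs with hi
  · have h2 : S \ {i} ≠ ∅ := by
      intro h
      have hsub : S ⊆ {i} := Finset.sdiff_eq_empty_iff_subset.mp h
      rcases Finset.subset_singleton_iff.mp hsub with h3 | h3
      · exact h0 h3
      · exact h1 h3
    have h3 : S \ {i} ≠ {i} := by
      intro h
      have : i ∈ S \ {i} := by rw [h]; exact Finset.mem_singleton_self i
      simp at this
    rw [coeff_lin, if_neg h2, if_neg h3, mul_zero]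
  · rfl

/-- Powers of `1 + b ε_i`: `(1 + b ε_i)^n = 1 + n b ε_i`. -/
theorem lin_one_pow (i : Fin k) (b : ℝ) (n : ℕ) : lin i 1 b ^ n = lin i 1 (n * b) := by
  induction n with
  | zero => rw [pow_zero, Nat.cast_zero, zero_mul, lin_one_zero]
  | succ n ih => rw [pow_succ, ih, lin_mul_lin]; push_cast; congr 1 <;> ring

/-- **Components of `x · ∏_{i ∈ I} (a_i + b_i ε_i)`**:
`(x ∏_{i∈I} lin_i)(S) = ∑_{J ⊆ I ∩ S} (∏_{i∈J} b_i)(∏_{i ∈ I∖J} a_i) x(S ∖ J)`. -/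
theorem coeff_mul_prod_lin (x : SAlg k) (a b : Fin k → ℝ) (I : Finset (Fin k)) :
    ∀ S : Finset (Fin k), coeff (x * ∏ i ∈ I, lin i (a i) (b i)) S =
      ∑ J ∈ (I ∩ S).powerset, (∏ i ∈ J, b i) * (∏ i ∈ I \ J, a i) * coeff x (S \ J) := by
  classical
  induction I using Finset.induction_on with
  | empty => intro S; simp
  | insert i₀ I hi₀ ih =>
    intro S
    rw [Finset.prod_insert hi₀, show x * (lin i₀ (a i₀) (b i₀) * ∏ i ∈ I, lin i (a i) (b i)) =
      (x * ∏ i ∈ I, lin i (a i) (b i)) * lin i₀ (a i₀) (b i₀) by ring, coeff_mul_lin, ih]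
    -- split the right-hand side according to `i₀ ∈ J`
    have hsplit : ((insert i₀ I) ∩ S).powerset =
        (I ∩ S).powerset ∪ (if i₀ ∈ S then ((I ∩ S).powerset.image (insert i₀)) else ∅) := by
      by_cases hS : i₀ ∈ S
      · rw [if_pos hS, Finset.insert_inter_of_mem hS, Finset.powerset_insert]
      · rw [if_neg hS, Finset.union_empty, Finset.insert_inter_of_notMem hS]
    have hdisj : Disjoint (I ∩ S).powerset
        (if i₀ ∈ S then ((I ∩ S).powerset.image (insert i₀)) else ∅) := by
      split_ifs with hS
      · rw [Finset.disjoint_left]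
        intro J hJ hJ'
        rw [Finset.mem_image] at hJ'
        obtain ⟨J', -, rfl⟩ := hJ'
        have : i₀ ∈ I ∩ S := Finset.mem_powerset.mp hJ (Finset.mem_insert_self i₀ J')
        exact hi₀ (Finset.mem_inter.mp this).1
      · exact disjoint_bot_right
    rw [hsplit, Finset.sum_union hdisj]
    congr 1
    · -- `i₀ ∉ J`
      rw [Finset.mul_sum]
      refine Finset.sum_congr rfl fun J hJ => ?_
      have hJI : J ⊆ I := (Finset.mem_powerset.mp hJ).trans Finset.inter_subset_left
      have hi₀J : i₀ ∉ J := fun h => hi₀ (hJI h)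
      rw [Finset.insert_sdiff_of_notMem _ hi₀J, Finset.prod_insert (fun h => hi₀ (Finset.mem_sdiff.mp h).1)]
      ring
    · -- `i₀ ∈ J`
      split_ifs with hS
      · rw [ih, Finset.mul_sum, Finset.sum_image]
        · have hIS : I ∩ (S \ {i₀}) = I ∩ S := by
            ext j
            simp only [Finset.mem_inter, Finset.mem_sdiff, Finset.mem_singleton]
            constructor
            · rintro ⟨h1, h2, -⟩; exact ⟨h1, h2⟩
            · rintro ⟨h1, h2⟩; exact ⟨h1, h2, fun h => hi₀ (h ▸ h1)⟩
          rw [hIS]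
          refine Finset.sum_congr rfl fun J hJ => ?_
          have hJI : J ⊆ I := (Finset.mem_powerset.mp hJ).trans Finset.inter_subset_left
          have hi₀J : i₀ ∉ J := fun h => hi₀ (hJI h)
          have e1 : insert i₀ I \ insert i₀ J = I \ J := by
            ext j
            simp only [Finset.mem_sdiff, Finset.mem_insert]
            constructor
            · rintro ⟨h1 | h1, h2⟩
              · exact absurd (Or.inl h1) h2
              · exact ⟨h1, fun h => h2 (Or.inr h)⟩
            · rintro ⟨h1, h2⟩
              exact ⟨Or.inr h1, fun h => h.elim (fun h3 => hi₀ (h3 ▸ h1)) h2⟩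
          have e2 : S \ insert i₀ J = (S \ {i₀}) \ J := by
            ext j
            simp only [Finset.mem_sdiff, Finset.mem_insert, Finset.mem_singleton]
            tauto
          rw [Finset.prod_insert hi₀J, e1, e2]
          ring
        · intro J hJ J' hJ' h
          have hJI : i₀ ∉ J := fun h' =>
            hi₀ ((Finset.mem_powerset.mp hJ).trans Finset.inter_subset_left h')
          have hJ'I : i₀ ∉ J' := fun h' =>
            hi₀ ((Finset.mem_powerset.mp hJ').trans Finset.inter_subset_left h')
          rw [← Finset.erase_insert hJI, h, Finset.erase_insert hJ'I]
      · simp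

/-- **Top coefficient of `x · ∏_i (a_i + b_i ε_i)`**:
`= ∑_{J} x(univ ∖ J) (∏_{i∈J} b_i)(∏_{i∉J} a_i)`. -/
theorem coeff_univ_mul_prod_lin (x : SAlg k) (a b : Fin k → ℝ) :
    coeff (x * ∏ i, lin i (a i) (b i)) Finset.univ =
      ∑ J : Finset (Fin k), (∏ i ∈ J, b i) * (∏ i ∈ Finset.univ \ J, a i) *
        coeff x (Finset.univ \ J) := by
  rw [coeff_mul_prod_lin, Finset.inter_self, Finset.powerset_univ]

/-- Top coefficient of `∏_i (a_i + b_i ε_i)` is `∏_i b_i`. -/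
theorem coeff_univ_prod_lin (a b : Fin k → ℝ) :
    coeff (∏ i, lin i (a i) (b i)) Finset.univ = ∏ i, b i := by
  have h := coeff_univ_mul_prod_lin 1 a b
  rw [one_mul] at h
  rw [h, Finset.sum_eq_single Finset.univ]
  · simp [coeff_one]
  · intro J _ hJ
    rw [coeff_one, if_neg, mul_zero]
    intro h0
    apply hJ
    exact Finset.univ_subset_iff.mp (Finset.sdiff_eq_empty_iff_subset.mp h0)
  · intro h; exact absurd (Finset.mem_univ _) h

/-- The `∅`-component of `x · ∏_i (a_i + b_i ε_i)` is `x(∅) ∏_i a_i`. -/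
theorem coeff_empty_mul_prod_lin (x : SAlg k) (a b : Fin k → ℝ) :
    coeff (x * ∏ i, lin i (a i) (b i)) ∅ = (∏ i, a i) * coeff x ∅ := by
  rw [coeff_mul_prod_lin, Finset.inter_empty, Finset.powerset_empty, Finset.sum_singleton]
  simp

/-- The `∅`-component is multiplicative: `(xy)(∅) = x(∅) y(∅)`. -/
theorem coeff_empty_mul (x y : SAlg k) : coeff (x * y) ∅ = coeff x ∅ * coeff y ∅ := by
  rw [coeff_mul, Finset.powerset_empty, Finset.sum_singleton, Finset.sdiff_self]

/-- `coeff (1 : SAlg k) ∅ = 1`. -/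
@[simp] theorem coeff_empty_one : coeff (1 : SAlg k) ∅ = 1 := by simp [coeff_one]

/-! ### The `ℓ¹` norm -/

/-- `0 ≤ norm1 x`. -/
theorem norm1_nonneg (x : SAlg k) : 0 ≤ norm1 x := Finset.sum_nonneg fun _ _ => abs_nonneg _

/-- `|coeff x S| ≤ norm1 x`. -/
theorem abs_coeff_le_norm1 (x : SAlg k) (S : Finset (Fin k)) : |coeff x S| ≤ norm1 x :=
  Finset.single_le_sum (f := fun S => |coeff x S|) (fun _ _ => abs_nonneg _) (Finset.mem_univ S)

/-- `norm1 (x + y) ≤ norm1 x + norm1 y`. -/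
theorem norm1_add_le (x y : SAlg k) : norm1 (x + y) ≤ norm1 x + norm1 y := by
  unfold norm1; rw [← Finset.sum_add_distrib]
  exact Finset.sum_le_sum fun S _ => by rw [coeff_add]; exact abs_add_le _ _

/-- `norm1 (-x) = norm1 x`. -/
theorem norm1_neg (x : SAlg k) : norm1 (-x) = norm1 x := by
  unfold norm1; exact Finset.sum_congr rfl fun S _ => by rw [coeff_neg, abs_neg]

/-- `norm1 (x - y) ≤ norm1 x + norm1 y`. -/
theorem norm1_sub_le (x y : SAlg k) : norm1 (x - y) ≤ norm1 x + norm1 y := by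
  rw [sub_eq_add_neg]; exact (norm1_add_le _ _).trans (by rw [norm1_neg])

/-- `norm1 (c • x) = |c| * norm1 x`. -/
theorem norm1_smul (c : ℝ) (x : SAlg k) : norm1 (c • x) = |c| * norm1 x := by
  unfold norm1; rw [Finset.mul_sum]
  exact Finset.sum_congr rfl fun S _ => by rw [coeff_smul, abs_mul]

/-- `norm1 (0 : SAlg k) = 0`. -/
theorem norm1_zero : norm1 (0 : SAlg k) = 0 := by simp [norm1]

/-- `‖∑ x_i‖₁ ≤ ∑ ‖x_i‖₁`. -/
theorem norm1_sum_le {ι : Type*} (s : Finset ι) (x : ι → SAlg k) :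
    norm1 (∑ i ∈ s, x i) ≤ ∑ i ∈ s, norm1 (x i) := by
  classical
  induction s using Finset.induction_on with
  | empty => simp [norm1_zero]
  | insert i s hi ih =>
    rw [Finset.sum_insert hi, Finset.sum_insert hi]
    exact (norm1_add_le _ _).trans (add_le_add le_rfl ih)

/-- **Submultiplicativity**: `norm1 (x y) ≤ norm1 x · norm1 y`. -/
theorem norm1_mul_le (x y : SAlg k) : norm1 (x * y) ≤ norm1 x * norm1 y := by
  classical
  unfold norm1
  calc ∑ S : Finset (Fin k), |coeff (x * y) S|
      ≤ ∑ S : Finset (Fin k), ∑ T ∈ S.powerset, |coeff x T| * |coeff y (S \ T)| := by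
        refine Finset.sum_le_sum fun S _ => ?_
        rw [coeff_mul]
        refine (Finset.abs_sum_le_sum_abs _ _).trans (le_of_eq ?_)
        exact Finset.sum_congr rfl fun T _ => abs_mul _ _
    _ = ∑ q ∈ (Finset.univ.sigma fun S : Finset (Fin k) => S.powerset).image
          (fun q => (q.2, q.1 \ q.2)), |coeff x q.1| * |coeff y q.2| := by
        rw [Finset.sum_sigma', Finset.sum_image]
        rintro ⟨S, T⟩ hST ⟨S', T'⟩ hST' h
        simp only [Finset.coe_sigma, Set.mem_sigma_iff, Finset.coe_univ, Set.mem_univ,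
          Finset.coe_powerset, Set.mem_preimage, Set.mem_powerset_iff, Finset.coe_subset,
          true_and] at hST hST'
        simp only [Prod.mk.injEq] at h
        obtain ⟨rfl, h2⟩ := h
        have : S = S' := by
          rw [← Finset.union_sdiff_of_subset hST, ← Finset.union_sdiff_of_subset hST', h2]
        subst this; rfl
    _ ≤ ∑ q ∈ (Finset.univ : Finset (Finset (Fin k))) ×ˢ (Finset.univ : Finset (Finset (Fin k))),
          |coeff x q.1| * |coeff y q.2| :=
        Finset.sum_le_sum_of_subset_of_nonneg (Finset.subset_univ _)
          fun q _ _ => mul_nonneg (abs_nonneg _) (abs_nonneg _)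
    _ = (∑ S, |coeff x S|) * ∑ S, |coeff y S| := by
        rw [Finset.sum_product, Finset.sum_mul]
        exact Finset.sum_congr rfl fun S _ => by rw [Finset.mul_sum]

/-- `norm1 (1 : SAlg k) = 1`. -/
theorem norm1_one : norm1 (1 : SAlg k) = 1 := by
  unfold norm1
  rw [Finset.sum_eq_single ∅ (fun S _ hS => by rw [coeff_one, if_neg hS, abs_zero])
    (fun h => absurd (Finset.mem_univ _) h)]
  simp [coeff_one]

/-- `‖∏ x_i‖₁ ≤ ∏ ‖x_i‖₁`. -/
theorem norm1_prod_le {ι : Type*} (s : Finset ι) (x : ι → SAlg k) :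
    norm1 (∏ i ∈ s, x i) ≤ ∏ i ∈ s, norm1 (x i) := by
  classical
  induction s using Finset.induction_on with
  | empty => simp [norm1_one]
  | insert i s hi ih =>
    rw [Finset.prod_insert hi, Finset.prod_insert hi]
    exact (norm1_mul_le _ _).trans (mul_le_mul_of_nonneg_left ih (norm1_nonneg _))

/-- `norm1 (x ^ n) ≤ norm1 x ^ n`. -/
theorem norm1_pow_le (x : SAlg k) (n : ℕ) : norm1 (x ^ n) ≤ norm1 x ^ n := by
  induction n with
  | zero => rw [pow_zero, pow_zero, norm1_one]
  | succ n ih =>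
    rw [pow_succ, pow_succ]
    exact (norm1_mul_le _ _).trans (mul_le_mul_of_nonneg_right ih (norm1_nonneg _))

/-- `norm1 (a + b ε_i) ≤ |a| + |b|`. -/
theorem norm1_lin_le (i : Fin k) (a b : ℝ) : norm1 (lin i a b) ≤ |a| + |b| := by
  classical
  unfold norm1
  have h : ∀ S : Finset (Fin k), |coeff (lin i a b) S| ≤
      (if S = ∅ then |a| else 0) + (if S = {i} then |b| else 0) := by
    intro S
    rw [coeff_lin]
    by_cases h0 : S = ∅
    · simp [h0]
    · by_cases h1 : S = {i}
      · subst h1; simp [Finset.singleton_ne_empty]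
      · simp [h0, h1]
  refine (Finset.sum_le_sum fun S _ => h S).trans ?_
  rw [Finset.sum_add_distrib, Finset.sum_ite_eq', Finset.sum_ite_eq']
  simp

end SAlg

end Summit.Parity.BatemanHorn.Theorems.TypeIMainTerm

end
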